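import Summits.NavierStokesRegularity.NavierStokesRegularity.Theorems.ScenarioCensusRowF19peak

/-!
# Census row F19 family, peak members — part 5/5 (§8 of REV 4): global corollaries — the PRESSURE-FORCE rows F-∇p / I-∇p
# and the pressure-force floors (sup norms, no argmax); NO census keys (lead g8 RULING 18:56Z: §8 rows are tree theorems
# noted on F19, not members of record)

Re-homed for the scenario census (typer seat ns-census-typer-1 g6; lead g8 RULING 2026-08-28T18:56Z: peak-push REV 4
`pub/ideators/ns-idea-3/lines/peak-push/line-peak-push.rev4.lean`, sha16 aec3fd608ab09a4a, 1153 l., is the source of record —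
REV 4 = REV 3 191fe95c2723e21c body 71/71 IDENTICAL (parts 1–4: `ScenarioCensusRowF19peakTop` → `…Floor` → `…Door` → `…F19peak`,
whose census keys `Row_F19gp` / `Row_F19ig` / `Row_F1peak` stay the only keys) + this §8; critic idea-crit-3 RE-STAMP 18:03:12Z
CONFORMS, ref g8 §13.6 ✓), §8 VERBATIM (l.1000–1149) in namespace `…Theorems.ScenarioCensus.PeakPush`; the `[folklore]` tags of
the four parameterless `def`s dropped (gate relocation rule); the §3 `variable` line repeated.

Cauchy–Schwarz `−⟪u,∇p⟫ ≤ ‖u‖ ‖∇p‖` turns the peak criteria into GLOBAL sup-norm criteria on the pressure force alone: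
`Row_Fgradp` (Clay frame, NO rate on `u`, eventually `‖∇p(t,x)‖ ≤ δ√ν(T−t)^{-3/2}` for all `x`, `0 ≤ δ < 9 − 2√15` ⇒ extension;
`rowFgradp_holds` via `rowPpeak_holds`), `Row_Igradp` (`‖∇p(t,·)‖_∞ ≤ g(t)` with a bounded primitive ⇒ extension; `rowIgradp_holds`
via `rowIpeak_holds`), and the structural floors `pressureForceFloor_holds` («limsup (T−t)^{3/2}‖∇p(t)‖_∞ ≥ (9 − 2√15)√ν» in the
`∀ δ, i.o.` form) and `pressureForceIntegralFloor_holds` («‖∇p(·)‖_∞ is dominated near `T` by no clock with a bounded primitive»).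

No census value is asserted here (record-only; no keys); NS regularity is NOT proved; `Row_F1` stays open; no summit statement is
proved by this file.
-/

noncomputable section

set_option linter.dupNamespace false

open MeasureTheory Set Function Filter TopologicalSpace Metric
open scoped Topology NNReal ENNReal Laplacian RealInnerProductSpace

namespace Summit.NavierStokesRegularity.NavierStokesRegularity.Theorems.ScenarioCensus.PeakPush

open Literature.Analysis Literature.Analysis.FluidPDE
open Summit.NavierStokesRegularity.NavierStokesRegularity.Theorems
open Summit.NavierStokesRegularity.FluidComputer.PalasekTowerClayBridge

variable {ν T : ℝ} {u : ℝ → E3 → E3} {p : ℝ → E3 → ℝ}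

/-! ## §8 (REV 4) Global corollaries: the PRESSURE-FORCE rows and floors (sup norms, no argmax)

Cauchy–Schwarz `−⟪u,∇p⟫ ≤ ‖u‖ ‖∇p‖` turns the peak criteria into GLOBAL sup-norm criteria on the pressure
force alone and the two floors into two necessary conditions on `‖∇p(t)‖_∞` in every Clay blow-up:
RATE FORM «limsup_{t↑T} (T−t)^{3/2} ‖∇p(t)‖_∞ / √ν ≥ 9 − 2√15» and INTEGRAL FORM «t ↦ ‖∇p(t)‖_∞ is
dominated near T by no clock with a bounded primitive» (the BKM-type statement for the pressure FORCE:
`∫^T ‖∇p‖_∞ dt = ∞`, weak sense).  Print neighbours: the Zhou–Struwe pressure-gradient class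
`∇p ∈ L^r_t L^s_x`, `2/r + 3/s = 3` (Zhou, Proc. AMS 134 (2006); Struwe, JMFM 9 (2007); refinements at
`s = ∞` to `L^{2/3}_t BMO_x` / `Ḃ⁰_{∞,∞}`, J. Inequal. Appl. 2008:412678) — the integral row below is its
`L¹_t L^∞_x` sub-case (print-dominated, kernel-new); the rate row is the SMALL-constant weak-`L^{2/3}_t L^∞_x`
endpoint (not found in print).  Tree precedent of the MECHANISM: `PalasekTowerSpeedLimit`'s
`PalasekTowerClayBridge.norm_le_of_gradPressure_le` (a CONSTANT bound `‖∇p‖ ≤ P` at running speed maxima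
⇒ the linear speed bound `‖u‖ ≤ A + P (t − T₁)`; no clock, no extension conclusion) — rows F-∇p / I-∇p
are its critical-clock (small constant) and integrable-clock (any size) versions composed with row F1a
through the peak floors. -/

/-- Subcritical pressure-FORCE rate near `T`: eventually `‖∇p(t,x)‖ ≤ δ√ν/((T−t)√(T−t))` for all `x`.
[folklore] -/
def HasSubcriticalPressureForce (ν T δ : ℝ) (p : ℝ → E3 → ℝ) : Prop :=
  ∀ᶠ t in 𝓝[<] T, ∀ x, ‖gradient (p t) x‖ ≤ δ * Real.sqrt ν / ((T - t) * Real.sqrt (T - t))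

/-- Dominated pressure FORCE near `T`: `‖∇p(t,x)‖ ≤ g(t)` for all `x`, eventually, for a clock `g` with a
bounded primitive on a final window (e.g. `∫^T ‖∇p‖_∞ dt < ∞` with `‖∇p(·)‖_∞` continuous). [folklore] -/
def HasDominatedPressureForce (T : ℝ) (p : ℝ → E3 → ℝ) : Prop :=
  ∃ (B T₀ : ℝ) (G g : ℝ → ℝ), T₀ < T ∧ (∀ t ∈ Ioo T₀ T, HasDerivAt G (g t) t) ∧
    (∀ t ∈ Ioo T₀ T, |G t| ≤ B) ∧ ∀ᶠ t in 𝓝[<] T, ∀ x, ‖gradient (p t) x‖ ≤ g t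

/-- **Row F-∇p** (no rate on `u` · no symmetry · Clay class): subcritical pressure-force rate with
`0 ≤ δ < 9 − 2√15` ⇒ smooth extension past `T`.  PROVED (`rowFgradp_holds`). -/
def Row_Fgradp : Prop :=
  ∀ (ν T δ : ℝ), 0 < ν → 0 < T → 0 ≤ δ → δ < 9 - 2 * Real.sqrt 15 →
    ∀ (u : ℝ → E3 → E3) (p : ℝ → E3 → ℝ),
    IsClassicalNSSolutionOn (Ico 0 T) ν 0 u p → IsLerayHopfOn T ν 0 (u 0) u →
    HasRapidSpatialDecay (u 0) → HasSubcriticalPressureForce ν T δ p → HasSmoothExtensionPast ν 0 u T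

/-- **Row I-∇p**: dominated pressure force ⇒ smooth extension past `T`.  PROVED (`rowIgradp_holds`); the
`L¹_t L^∞_x` sub-case of the Zhou–Struwe class. -/
def Row_Igradp : Prop :=
  ∀ (ν T : ℝ), 0 < ν → 0 < T →
    ∀ (u : ℝ → E3 → E3) (p : ℝ → E3 → ℝ),
    IsClassicalNSSolutionOn (Ico 0 T) ν 0 u p → IsLerayHopfOn T ν 0 (u 0) u →
    HasRapidSpatialDecay (u 0) → HasDominatedPressureForce T p → HasSmoothExtensionPast ν 0 u T

/-- **Structural statement «the pressure-force floor» (rate form)**: in every Clay blow-up (maximal,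
Leray–Hopf, decaying datum; ANY rate), for every `0 ≤ δ < 9 − 2√15` and `t₁ < T` there are `t ∈ (t₁,T)`
and `x` with `‖∇p(t,x)‖ > δ√ν/((T−t)√(T−t))`: `limsup (T−t)^{3/2}‖∇p(t)‖_∞ ≥ (9 − 2√15)√ν`.  PROVED
(`pressureForceFloor_holds`). -/
def PressureForceFloor : Prop :=
  ∀ (ν T : ℝ), 0 < ν → 0 < T →
    ∀ (u : ℝ → E3 → E3) (p : ℝ → E3 → ℝ),
    IsMaximalSmoothSolution ν 0 u p T → IsLerayHopfOn T ν 0 (u 0) u → HasRapidSpatialDecay (u 0) →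
    ∀ (δ t₁ : ℝ), 0 ≤ δ → δ < 9 - 2 * Real.sqrt 15 → t₁ < T →
      ∃ t ∈ Ioo t₁ T, ∃ x, δ * Real.sqrt ν / ((T - t) * Real.sqrt (T - t)) < ‖gradient (p t) x‖

/-- **Structural statement «the pressure-force floor» (integral form)**: in every Clay blow-up, for every
clock `g` with a primitive bounded on a final window and every `t₁ < T` there are `t ∈ (t₁,T)` and `x`
with `‖∇p(t,x)‖ > g(t)` — `‖∇p(·)‖_∞` is integrably dominated by nothing up to `T`.  PROVED
(`pressureForceIntegralFloor_holds`). -/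
def PressureForceIntegralFloor : Prop :=
  ∀ (ν T : ℝ), 0 < ν → 0 < T →
    ∀ (u : ℝ → E3 → E3) (p : ℝ → E3 → ℝ),
    IsMaximalSmoothSolution ν 0 u p T → IsLerayHopfOn T ν 0 (u 0) u → HasRapidSpatialDecay (u 0) →
    ∀ (B T₀ : ℝ) (G g : ℝ → ℝ) (t₁ : ℝ), T₀ < T → (∀ t ∈ Ioo T₀ T, HasDerivAt G (g t) t) →
      (∀ t ∈ Ioo T₀ T, |G t| ≤ B) → t₁ < T →
      ∃ t ∈ Ioo t₁ T, ∃ x, g t < ‖gradient (p t) x‖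

/-- Cauchy–Schwarz at a point: `−⟪u,∇p⟫ ≤ ‖∇p‖ ‖u‖`. [folklore] -/
theorem neg_inner_gradient_le (v w : E3) : -⟪v, w⟫ ≤ ‖w‖ * ‖v‖ := by
  have h := abs_real_inner_le_norm v w
  have h' : -⟪v, w⟫ ≤ |⟪v, w⟫| := neg_le_abs _
  nlinarith [h, h']

/-- Edge: subcritical pressure force ⇒ subcritical peak push (same `δ`, `Λ = 0`; `ν ≥ 0`). [folklore] -/
theorem hasSubcriticalPeakPush_of_pressureForce (hν : 0 ≤ ν) {δ : ℝ}
    (h : HasSubcriticalPressureForce ν T δ p) : HasSubcriticalPeakPush ν T δ u p := by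
  refine ⟨0, ?_⟩
  filter_upwards [h] with t ht x _ _
  have h1 := neg_inner_gradient_le (u t x) (gradient (p t) x)
  have h2 : ‖gradient (p t) x‖ * ‖u t x‖ ≤ δ * Real.sqrt ν / ((T - t) * Real.sqrt (T - t)) * ‖u t x‖ :=
    mul_le_mul_of_nonneg_right (ht x) (norm_nonneg _)
  have h3 : 0 ≤ ν * frobeniusNormSq (fderiv ℝ (u t) x) :=
    mul_nonneg hν (Finset.sum_nonneg fun _ _ => sq_nonneg _)
  linarith

/-- Edge: dominated pressure force ⇒ dominated peak push (same clock, `Λ = 0`; `ν ≥ 0`). [folklore] -/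
theorem hasDominatedPeakPush_of_pressureForce (hν : 0 ≤ ν) (h : HasDominatedPressureForce T p) :
    HasDominatedPeakPush ν T u p := by
  obtain ⟨B, T₀, G, g, hT₀, hG, hGB, hev⟩ := h
  refine ⟨0, B, T₀, G, g, hT₀, hG, hGB, ?_⟩
  filter_upwards [hev] with t ht x _ _
  have h1 := neg_inner_gradient_le (u t x) (gradient (p t) x)
  have h2 : ‖gradient (p t) x‖ * ‖u t x‖ ≤ g t * ‖u t x‖ :=
    mul_le_mul_of_nonneg_right (ht x) (norm_nonneg _)
  have h3 : 0 ≤ ν * frobeniusNormSq (fderiv ℝ (u t) x) :=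
    mul_nonneg hν (Finset.sum_nonneg fun _ _ => sq_nonneg _)
  linarith

/-- **Row F-∇p from row P-peak.** [folklore] -/
theorem rowFgradp_of_rowPpeak (h : Row_Ppeak) : Row_Fgradp :=
  fun ν T δ hν hT hδ hδlt u p hsol hLH hdec hP =>
    h ν T δ hν hT hδ hδlt u p hsol hLH hdec (hasSubcriticalPeakPush_of_pressureForce hν.le hP)

/-- **Row I-∇p from row I-peak.** [folklore] -/
theorem rowIgradp_of_rowIpeak (h : Row_Ipeak) : Row_Igradp :=
  fun ν T hν hT u p hsol hLH hdec hP =>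
    h ν T hν hT u p hsol hLH hdec (hasDominatedPeakPush_of_pressureForce hν.le hP)

/-- **Row F-∇p: EXCLUDED.** [folklore] -/
theorem rowFgradp_holds : Row_Fgradp := rowFgradp_of_rowPpeak rowPpeak_holds

/-- **Row I-∇p: EXCLUDED.** [folklore] -/
theorem rowIgradp_holds : Row_Igradp := rowIgradp_of_rowIpeak rowIpeak_holds

/-- **The pressure-force floor (rate form) from the peak-push floor.** [folklore] -/
theorem pressureForceFloor_of_peakPushFloor (h : PeakPushFloor) : PressureForceFloor := by
  intro ν T hν hT u p hmax hLH hdec δ t₁ hδ hδlt ht₁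
  obtain ⟨t, ht, x, -, hΛ, hpush, -⟩ := h ν T hν hT u p hmax hLH hdec δ 0 t₁ hδ hδlt ht₁
  refine ⟨t, ht, x, ?_⟩
  have h1 := neg_inner_gradient_le (u t x) (gradient (p t) x)
  have h3 : 0 ≤ ν * frobeniusNormSq (fderiv ℝ (u t) x) :=
    mul_nonneg hν.le (Finset.sum_nonneg fun _ _ => sq_nonneg _)
  by_contra hle
  push Not at hle
  have h2 : ‖gradient (p t) x‖ * ‖u t x‖ ≤ δ * Real.sqrt ν / ((T - t) * Real.sqrt (T - t)) * ‖u t x‖ :=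
    mul_le_mul_of_nonneg_right hle (norm_nonneg _)
  linarith

/-- **The pressure-force floor (integral form) from the integral peak floor.** [folklore] -/
theorem pressureForceIntegralFloor_of_integralPeakFloor (h : IntegralPeakFloor) :
    PressureForceIntegralFloor := by
  intro ν T hν hT u p hmax hLH hdec B T₀ G g t₁ hT₀ hG hGB ht₁
  obtain ⟨t, ht, x, -, hΛ, hpush, -⟩ := h ν T hν hT u p hmax hLH hdec 0 B T₀ G g t₁ hT₀ hG hGB ht₁
  refine ⟨t, ht, x, ?_⟩
  have h1 := neg_inner_gradient_le (u t x) (gradient (p t) x)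
  have h3 : 0 ≤ ν * frobeniusNormSq (fderiv ℝ (u t) x) :=
    mul_nonneg hν.le (Finset.sum_nonneg fun _ _ => sq_nonneg _)
  by_contra hle
  push Not at hle
  have h2 : ‖gradient (p t) x‖ * ‖u t x‖ ≤ g t * ‖u t x‖ :=
    mul_le_mul_of_nonneg_right hle (norm_nonneg _)
  linarith

/-- **Pressure-force floor (rate form): PROVED.** [folklore] -/
theorem pressureForceFloor_holds : PressureForceFloor :=
  pressureForceFloor_of_peakPushFloor peakPushFloor_holds

/-- **Pressure-force floor (integral form): PROVED.** [folklore] -/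
theorem pressureForceIntegralFloor_holds : PressureForceIntegralFloor :=
  pressureForceIntegralFloor_of_integralPeakFloor integralPeakFloor_holds


end Summit.NavierStokesRegularity.NavierStokesRegularity.Theorems.ScenarioCensus.PeakPush

end
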